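import Mathlib
import Summits.ValiantsHypothesis.ValiantsHypothesis.Theses.RefutationDegree
import Literature.Computability.AlgebraicComplexity.DeterminantalComplexity
import Literature.Computability.AlgebraicComplexity.StandardFamilies
import Literature.Computability.AlgebraicComplexity.HessianAtOrigin
import Literature.Computability.AlgebraicComplexity.HessianRank
import Literature.Computability.AlgebraicComplexity.MignonRessayreBound
import Literature.Computability.AlgebraicComplexity.LRPencilOfMatrix
import Literature.Computability.AlgebraicComplexity.LandsbergRessayreNormalForm
import Literature.Computability.AlgebraicComplexity.AlperBogartVelascoLowOrder
import Literature.Computability.AlgebraicComplexity.AlperBogartVelascoSubspace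
import Summits.ValiantsHypothesis.ValiantsHypothesis.Theorems.RefutationDegreeBeyondHessianNsStubHess0DetLamMatrix
import Summits.ValiantsHypothesis.ValiantsHypothesis.Theorems.RefutationDegreeBeyondHessianNsStubConjTransl
import Summits.ValiantsHypothesis.ValiantsHypothesis.Theorems.RefutationDegreeBeyondHessianNsStubAdjugateRowCol

/-!
# The point lemma at the Mignon–Ressayre point (line `Sketch`, crux `BeyondHessianNs`, stmt-ValiantsHypothesis-5641)

`per_n = det A` with `A` affine of size `N`, `n = m + 3`, `y₀` the Mignon–Ressayre point, `A₀ = A(0)`.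
**Point lemma** (`sq_add_two_le_of_kernelPair_ne`): if the kernel pair of `A(y₀)` is not a kernel pair of
`A₀` — `adj A(y₀) · A₀ ≠ 0` or `A₀ · adj A(y₀) ≠ 0` — then `n² + 2 ≤ 2N`.

The file first proves the pure linear-algebra count behind it (`card_le_two_mul_of_row_or_col_ne_zero`: under
the Hessian formula (hH), non-degeneracy, Euler `H x = κ l`, `l · x = 0` and a non-zero `r_j · x` or `c_j · x`,
`#vars ≤ 2 #J` — Gauss rigidity `smul_eq_smul_of_forms_eq_zero` + a proper hyperplane), then the point lemma, and
records it under the registered stub name `stub_pointLemma`.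

Proof of the point lemma: `A(y₀)` has corank one (von zur Gathen regularity, tree
`AlperBogartVelasco.le_rank_map_eval_add_one`), so `V · A(y₀) · U = Λ_{i₀}` for invertible `V, U`
(tree `exists_mul_mul_eq_lamMatrix`); for `B = V · A(X + y₀) · U = Λ_{i₀} + Z` (`stub_conj_transl`) the
Hessian of `det B` at `0` is `l tᵀ + t lᵀ - Σ_{s ≠ i₀} (r_s c_sᵀ + c_s r_sᵀ)` (`stub_hess0_det_lamMatrix`)
and equals `det V det U · (n-3)! · mrHess`, non-degenerate (tree `mrHess_mulVec_injective`); Euler's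
identities at `y₀` (`euler_transl`) give `H y₀ = (n - 1) l`, `l · y₀ = 0`; the hypothesis becomes
`r_s · y₀ ≠ 0` or `c_s · y₀ ≠ 0` for some `s ≠ i₀` (`stub_adjugate_row_col`); the count
`card_le_two_mul_of_row_or_col_ne_zero` gives `n² ≤ 2(N - 1)`.
-/

noncomputable section

-- `Summit.ValiantsHypothesis.ValiantsHypothesis.…` is the tree's mandated single-conjunct layout.
set_option linter.dupNamespace false

namespace Summit.ValiantsHypothesis.ValiantsHypothesis.Theorems.RefutationDegreeBeyondHessianNs

open MvPolynomial Matrix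
open Literature.Computability.AlgebraicComplexity

section PointCount

variable {K : Type*} [Field K] {ι : Type*} [Fintype ι] {J : Type*} [Fintype J]

/-- **Gauss rigidity, first order**: under (hH) and Euler `H x = κ l`, a vector `u` killed by `l`,
all `r_j` and all `c_j` satisfies `κ u = (t·u) x`. [folklore] -/
theorem smul_eq_smul_of_forms_eq_zero (l t x : ι → K) (r c : J → ι → K) (H : Matrix ι ι K)
    (κ : K)
    (hH : ∀ u, H *ᵥ u = (t ⬝ᵥ u) • l + (l ⬝ᵥ u) • t - ∑ j, ((c j ⬝ᵥ u) • r j + (r j ⬝ᵥ u) • c j))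
    (hinj : Function.Injective H.mulVec) (heuler : H *ᵥ x = κ • l)
    (u : ι → K) (hlu : l ⬝ᵥ u = 0) (hru : ∀ j, r j ⬝ᵥ u = 0) (hcu : ∀ j, c j ⬝ᵥ u = 0) :
    κ • u = (t ⬝ᵥ u) • x := by
  have hHu : H *ᵥ u = (t ⬝ᵥ u) • l := by
    rw [hH u, hlu, zero_smul, add_zero]
    simp [hru, hcu]
  apply hinj
  simp only [Matrix.mulVec_smul, hHu, heuler, smul_smul, mul_comm κ]

/-- **Case B′ count.** If some `r_j(x) ≠ 0` or some `c_j(x) ≠ 0`, then `#ι ≤ 2 #J`. [folklore] -/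
theorem card_le_two_mul_of_row_or_col_ne_zero (l t x : ι → K) (r c : J → ι → K)
    (H : Matrix ι ι K) (κ : K) (hκ : κ ≠ 0)
    (hH : ∀ u, H *ᵥ u = (t ⬝ᵥ u) • l + (l ⬝ᵥ u) • t - ∑ j, ((c j ⬝ᵥ u) • r j + (r j ⬝ᵥ u) • c j))
    (hinj : Function.Injective H.mulVec) (heuler : H *ᵥ x = κ • l) (hlx : l ⬝ᵥ x = 0)
    (hB : (∃ j, r j ⬝ᵥ x ≠ 0) ∨ (∃ j, c j ⬝ᵥ x ≠ 0)) :
    Fintype.card ι ≤ 2 * Fintype.card J := by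
  classical
  let L : (ι → K) →ₗ[K] K :=
    { toFun := fun z => l ⬝ᵥ z
      map_add' := fun z z' => dotProduct_add l z z'
      map_smul' := fun a z => by simp }
  have hT : Fintype.card ι ≤ Module.finrank K (LinearMap.ker L) + 1 := by
    have h1 := LinearMap.finrank_range_add_finrank_ker L
    have h2 : Module.finrank K (LinearMap.range L) ≤ 1 := by
      calc Module.finrank K (LinearMap.range L) ≤ Module.finrank K K := Submodule.finrank_le _
        _ = 1 := Module.finrank_self K
    have h3 : Module.finrank K (ι → K) = Fintype.card ι := by simp
    omega
  let Φ : (ι → K) →ₗ[K] (J → K) × (J → K) :=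
    LinearMap.prod (Matrix.mulVecLin (Matrix.of r)) (Matrix.mulVecLin (Matrix.of c))
  have hΦ : ∀ z, Φ z = (fun j => r j ⬝ᵥ z, fun j => c j ⬝ᵥ z) := fun z => rfl
  have hΦx : Φ x ≠ 0 := by
    rw [hΦ]
    rcases hB with ⟨j, hj⟩ | ⟨j, hj⟩
    · intro h
      exact hj (by simpa using congrFun (Prod.mk.inj h).1 j)
    · intro h
      exact hj (by simpa using congrFun (Prod.mk.inj h).2 j)
  let Ψ := Φ.domRestrict (LinearMap.ker L)
  have hΨinj : Function.Injective Ψ := by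
    rw [← LinearMap.ker_eq_bot, Submodule.eq_bot_iff]
    intro u hu
    rw [LinearMap.mem_ker, LinearMap.domRestrict_apply] at hu
    have hlu : l ⬝ᵥ (u : ι → K) = 0 := u.2
    have hru : ∀ j, r j ⬝ᵥ (u : ι → K) = 0 := fun j =>
      congrFun (Prod.mk.inj (hu.trans (Prod.zero_eq_mk).symm)).1 j
    have hcu : ∀ j, c j ⬝ᵥ (u : ι → K) = 0 := fun j =>
      congrFun (Prod.mk.inj (hu.trans (Prod.zero_eq_mk).symm)).2 j
    have key := smul_eq_smul_of_forms_eq_zero l t x r c H κ hH hinj heuler u hlu hru hcu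
    have hΦu : κ • Φ u = (t ⬝ᵥ (u : ι → K)) • Φ x := by
      rw [← map_smul, ← map_smul, key]
    rw [hu, smul_zero] at hΦu
    have htu : t ⬝ᵥ (u : ι → K) = 0 := by
      by_contra h
      exact hΦx (smul_right_injective _ h (hΦu.symm.trans (smul_zero _).symm))
    rw [htu, zero_smul, smul_eq_zero] at key
    exact Subtype.ext (key.resolve_left hκ)
  let Λ : (J → K) × (J → K) →ₗ[K] K :=
    { toFun := fun p => (fun j => c j ⬝ᵥ x) ⬝ᵥ p.1 + (fun j => r j ⬝ᵥ x) ⬝ᵥ p.2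
      map_add' := fun p q => by
        simp only [Prod.fst_add, Prod.snd_add, dotProduct_add]; ring
      map_smul' := fun a p => by
        simp only [Prod.smul_fst, Prod.smul_snd, dotProduct_smul, smul_eq_mul, RingHom.id_apply]
        ring }
  have hId : ∑ j, ((c j ⬝ᵥ x) • r j + (r j ⬝ᵥ x) • c j) = (t ⬝ᵥ x - κ) • l := by
    have h := hH x
    rw [heuler, hlx, zero_smul, add_zero] at h
    rw [sub_smul, h]; abel
  have hrange : LinearMap.range Ψ ≤ LinearMap.ker Λ := by
    rintro _ ⟨u, rfl⟩
    rw [LinearMap.mem_ker, LinearMap.domRestrict_apply, hΦ]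
    have hlu : l ⬝ᵥ (u : ι → K) = 0 := u.2
    have h := congrArg (fun w => w ⬝ᵥ (u : ι → K)) hId
    simp only [sum_dotProduct, add_dotProduct, smul_dotProduct, smul_eq_mul,
      hlu, mul_zero] at h
    show (fun j => c j ⬝ᵥ x) ⬝ᵥ (fun j => r j ⬝ᵥ (u : ι → K)) +
      (fun j => r j ⬝ᵥ x) ⬝ᵥ (fun j => c j ⬝ᵥ (u : ι → K)) = 0
    rw [← h, dotProduct, dotProduct, ← Finset.sum_add_distrib]
  have hΛ : LinearMap.ker Λ ≠ ⊤ := by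
    intro htop
    rcases hB with ⟨j, hj⟩ | ⟨j, hj⟩
    · have : ((0 : J → K), Pi.single j (1 : K)) ∈ LinearMap.ker Λ := htop ▸ Submodule.mem_top
      rw [LinearMap.mem_ker] at this
      simp [Λ] at this
      exact hj this
    · have : (Pi.single j (1 : K), (0 : J → K)) ∈ LinearMap.ker Λ := htop ▸ Submodule.mem_top
      rw [LinearMap.mem_ker] at this
      simp [Λ] at this
      exact hj this
  have hker : Module.finrank K (LinearMap.ker Λ) + 1 ≤ 2 * Fintype.card J := by
    have hlt : Module.finrank K (LinearMap.ker Λ) <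
        Module.finrank K ((J → K) × (J → K)) :=
      Submodule.finrank_lt hΛ
    have : Module.finrank K ((J → K) × (J → K)) = 2 * Fintype.card J := by
      rw [Module.finrank_prod]; simp; ring
    omega
  have h1 : Module.finrank K (LinearMap.ker L) = Module.finrank K (LinearMap.range Ψ) :=
    (LinearMap.finrank_range_of_inj hΨinj).symm
  have h2 : Module.finrank K (LinearMap.range Ψ) ≤ Module.finrank K (LinearMap.ker Λ) :=
    Submodule.finrank_mono hrange
  omega

end PointCount


section OddStep

variable {K : Type*} [Field K] [CharZero K]

omit [CharZero K] in
/-- **Euler's identities at a point, in `hess0`/`linPart` form**: for `f` homogeneous of degree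
`d`, `Hess f(x) · x = (d - 1) ∇f(x)` and `∇f(x) · x = d f(x)`, written for the translate `f(X + x)`
(`hess0_transl`, `pderiv_transl`, `constantCoeff_transl`, Mathlib `IsHomogeneous.sum_X_mul_pderiv`
applied to `f` and to `∂_a f`). [folklore] -/
theorem euler_transl {ι : Type*} [Fintype ι] [DecidableEq ι]
    (f : MvPolynomial ι K) {d : ℕ} (hf : f.IsHomogeneous d) (x : ι → K) :
    hess0 (transl x f) *ᵥ x = ((d : K) - 1) • linPart (transl x f) ∧
    linPart (transl x f) ⬝ᵥ x = (d : K) * eval x f := by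
  have hlin : ∀ a, linPart (transl x f) a = eval x (pderiv a f) := fun a => by
    rw [linPart_apply, pderiv_transl, constantCoeff_transl]
  constructor
  · funext a
    simp only [Matrix.mulVec, dotProduct, Pi.smul_apply, smul_eq_mul, hlin]
    have hE := (hf.pderiv (i := a)).sum_X_mul_pderiv
    have hE' := congrArg (eval x) hE
    rw [map_sum, map_nsmul] at hE'
    simp only [map_mul, eval_X] at hE'
    have hcomm : ∀ b, hess0 (transl x f) a b * x b = x b * eval x (pderiv b (pderiv a f)) := by
      intro b
      rw [hess0_transl, pderiv_pderiv_comm a b f, mul_comm]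
    rw [Finset.sum_congr rfl fun b _ => hcomm b, hE', nsmul_eq_mul]
    rcases Nat.eq_zero_or_pos d with rfl | hd
    · have hf0 : pderiv a f = 0 := by
        rw [← totalDegree_zero_iff_isHomogeneous, totalDegree_eq_zero_iff_eq_C] at hf
        rw [hf, pderiv_C]
      simp [hf0]
    · rw [Nat.cast_sub hd, Nat.cast_one]
  · simp only [dotProduct, hlin]
    have hE := congrArg (eval x) hf.sum_X_mul_pderiv
    rw [map_sum, map_nsmul] at hE
    simp only [map_mul, eval_X] at hE
    rw [nsmul_eq_mul] at hE
    rw [← hE]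
    exact Finset.sum_congr rfl fun a _ => mul_comm _ _

/-- **POINT LEMMA** (case B′ at the Mignon–Ressayre point): if `per_n = det A` (`n = m + 3`, `A` affine
of size `N`) and the kernel pair of `A(y₀)` is not a kernel pair of `A₀ = A(0)` — i.e.
`adj A(y₀) · A₀ ≠ 0` or `A₀ · adj A(y₀) ≠ 0` — then `n² + 2 ≤ 2N`. -/
theorem sq_add_two_le_of_kernelPair_ne {m N : ℕ}
    (A : Matrix (Fin N) (Fin N) (MvPolynomial (Fin (m + 3) × Fin (m + 3)) K))
    (hA : IsAffineDetRepr (perPoly (Fin (m + 3)) K) A)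
    (hB : (A.map (eval (mrPoint K m))).adjugate * constPart A ≠ 0 ∨
      constPart A * (A.map (eval (mrPoint K m))).adjugate ≠ 0) :
    (m + 3) ^ 2 + 2 ≤ 2 * N := by
  classical
  obtain ⟨hdeg, hdet⟩ := hA
  -- `N ≥ 1`
  have hN : 0 < N := by
    rcases Nat.eq_zero_or_pos N with rfl | h
    · exfalso
      have h0 := constantCoeff_perPoly K (show 1 ≤ m + 3 by omega)
      rw [← hdet, Matrix.det_isEmpty, map_one] at h0
      exact one_ne_zero h0
    · exact h
  -- `det A(y₀) = per(y₀) = 0` and `rank A(y₀) = N - 1` (von zur Gathen)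
  have hMdet : (A.map (eval (mrPoint K m))).det = 0 := by
    rw [← RingHom.mapMatrix_apply, ← RingHom.map_det, hdet, eval_mrPoint_perPoly]
  have hrank : (A.map (eval (mrPoint K m))).rank = Fintype.card (Fin N) - 1 := by
    have hge := AlperBogartVelasco.le_rank_map_eval_add_one (two_ne_zero : (2 : K) ≠ 0)
      (by omega : 3 ≤ m + 3) A hdet (mrPoint K m)
    have hlt := Matrix.rank_lt_card_of_det_eq_zero hMdet
    rw [Fintype.card_fin] at hlt ⊢
    omega
  obtain ⟨V, U, i₀, hV, hU, hVMU⟩ := exists_mul_mul_eq_lamMatrix (A.map (eval (mrPoint K m))) hrank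
    (by rw [Fintype.card_fin]; exact hN)
  have hVdet : V.det ≠ 0 := ((Matrix.isUnit_iff_isUnit_det V).mp hV).ne_zero
  have hUdet : U.det ≠ 0 := ((Matrix.isUnit_iff_isUnit_det U).mp hU).ne_zero
  -- the normal form `B = V · A(X + y₀) · U = Λ_{i₀} + Z`
  obtain ⟨hB1, hBdet, hB0, hdict⟩ := stub_conj_transl A hdeg (mrPoint K m) V U
  set B := V.map (C : K →+* MvPolynomial (Fin (m + 3) × Fin (m + 3)) K) *
    A.map (transl (mrPoint K m)) *
    U.map (C : K →+* MvPolynomial (Fin (m + 3) × Fin (m + 3)) K) with hBdef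
  rw [hVMU] at hB0
  rw [hdet] at hBdet
  set κ : K := V.det * U.det with hκdef
  have hκ : κ ≠ 0 := mul_ne_zero hVdet hUdet
  -- the vectors of the normal form
  set l : Fin (m + 3) × Fin (m + 3) → K := fun a => LRPencil.coeffMat B a i₀ i₀ with hldef
  set t : Fin (m + 3) × Fin (m + 3) → K :=
    fun a => ∑ s ∈ Finset.univ.erase i₀, LRPencil.coeffMat B a s s with htdef
  set r : ↥(Finset.univ.erase i₀) → Fin (m + 3) × Fin (m + 3) → K :=
    fun s a => LRPencil.coeffMat B a i₀ s with hrdef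
  set c : ↥(Finset.univ.erase i₀) → Fin (m + 3) × Fin (m + 3) → K :=
    fun s a => LRPencil.coeffMat B a s i₀ with hcdef
  set H := hess0 B.det with hHdef
  -- (hH): the Hessian formula
  have hH : ∀ u, H *ᵥ u = (t ⬝ᵥ u) • l + (l ⬝ᵥ u) • t -
      ∑ j, ((c j ⬝ᵥ u) • r j + (r j ⬝ᵥ u) • c j) := by
    intro u
    funext a
    have hrow : ∀ b, H a b = l a * t b + l b * t a -
        ∑ j : ↥(Finset.univ.erase i₀), (r j a * c j b + r j b * c j a) := by
      intro b
      rw [hHdef, stub_hess0_det_lamMatrix B hB1 i₀ hB0 a b,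
        ← Finset.sum_coe_sort (Finset.univ.erase i₀) (fun s =>
          LRPencil.coeffMat B a i₀ s * LRPencil.coeffMat B b s i₀ +
            LRPencil.coeffMat B b i₀ s * LRPencil.coeffMat B a s i₀)]
    have hrow' : ∀ b, H a b * u b = t b * u b * l a + l b * u b * t a -
        ∑ j, (c j b * u b * r j a + r j b * u b * c j a) := by
      intro b
      rw [hrow b, sub_mul, add_mul, Finset.sum_mul]
      congr 1
      · ring
      · exact Finset.sum_congr rfl fun j _ => by ring
    calc (H *ᵥ u) a = ∑ b, H a b * u b := rfl
      _ = ∑ b, (t b * u b * l a + l b * u b * t a) -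
            ∑ b, ∑ j, (c j b * u b * r j a + r j b * u b * c j a) := by
          rw [← Finset.sum_sub_distrib]
          exact Finset.sum_congr rfl fun b _ => hrow' b
      _ = (∑ b, t b * u b) * l a + (∑ b, l b * u b) * t a -
            ∑ j, ((∑ b, c j b * u b) * r j a + (∑ b, r j b * u b) * c j a) := by
          rw [Finset.sum_add_distrib, Finset.sum_mul, Finset.sum_mul, Finset.sum_comm]
          congr 1
          exact Finset.sum_congr rfl fun j _ => by
            rw [Finset.sum_add_distrib, Finset.sum_mul, Finset.sum_mul]
      _ = ((t ⬝ᵥ u) • l + (l ⬝ᵥ u) • t - ∑ j, ((c j ⬝ᵥ u) • r j + (r j ⬝ᵥ u) • c j)) a := by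
          simp only [Pi.add_apply, Pi.sub_apply, Pi.smul_apply, Finset.sum_apply, smul_eq_mul,
            dotProduct]
  -- non-degeneracy: `H = κ m! · mrHess`
  have hHeq : H = κ • hess0 (transl (mrPoint K m) (perPoly (Fin (m + 3)) K)) := by
    rw [hHdef, hBdet, hess0_C_mul]
  have hinj : Function.Injective H.mulVec := by
    rw [hHeq, hess0_transl_mrPoint_perPoly, smul_smul]
    intro u v huv
    apply mrHess_mulVec_injective (k := K) (m := m)
    have hne : κ * (m.factorial : K) ≠ 0 :=
      mul_ne_zero hκ (by exact_mod_cast Nat.factorial_ne_zero m)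
    rw [Matrix.smul_mulVec, Matrix.smul_mulVec] at huv
    exact smul_right_injective _ hne huv
  -- Euler
  have hhom : (perPoly (Fin (m + 3)) K).IsHomogeneous (m + 3) := by
    simpa [Fintype.card_fin] using (perPoly_isHomogeneous (n := Fin (m + 3)) (k := K))
  obtain ⟨hE1, hE2⟩ := euler_transl (perPoly (Fin (m + 3)) K) hhom (mrPoint K m)
  have hl : l = κ • linPart (transl (mrPoint K m) (perPoly (Fin (m + 3)) K)) := by
    funext a
    rw [hldef]
    simp only [Pi.smul_apply, smul_eq_mul]
    rw [← AlperBogartVelasco.constantCoeff_pderiv_det hB1 hB0 a, hBdet, pderiv_C_mul, map_mul,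
      constantCoeff_C, linPart_apply]
  have heuler : H *ᵥ (mrPoint K m) = (((m + 3 : ℕ) : K) - 1) • l := by
    rw [hHeq, Matrix.smul_mulVec, hE1, hl, smul_smul, smul_smul, mul_comm]
  have hlx : l ⬝ᵥ (mrPoint K m) = 0 := by
    rw [hl, smul_dotProduct, hE2, eval_mrPoint_perPoly, mul_zero, smul_zero]
  -- the hypothesis in vector form
  obtain ⟨-, hrowA, hcolA⟩ := stub_adjugate_row_col (A.map (eval (mrPoint K m))) (constPart A) V U i₀
    hV hU hVMU
  have hentry : ∀ i j, (V * constPart A * U) i j =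
      lamMatrix K i₀ i j - (fun a => LRPencil.coeffMat B a i j) ⬝ᵥ (mrPoint K m) := by
    intro i j
    rw [hdict, Matrix.sub_apply, hB0, Matrix.sum_apply]
    congr 1
    simp only [Matrix.smul_apply, smul_eq_mul, dotProduct]
    exact Finset.sum_congr rfl fun a _ => mul_comm _ _
  have hBvec : (∃ j, r j ⬝ᵥ (mrPoint K m) ≠ 0) ∨ (∃ j, c j ⬝ᵥ (mrPoint K m) ≠ 0) := by
    rcases hB with h | h
    · left
      obtain ⟨s, hs⟩ := hrowA h
      rw [hentry] at hs
      have hsi : s ≠ i₀ := by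
        rintro rfl
        apply hs
        have : (fun a => LRPencil.coeffMat B a s s) ⬝ᵥ mrPoint K m = 0 := hlx
        rw [this]
        simp [lamMatrix_apply]
      refine ⟨⟨s, Finset.mem_erase.mpr ⟨hsi, Finset.mem_univ _⟩⟩, fun h0 => hs ?_⟩
      have : (fun a => LRPencil.coeffMat B a i₀ s) ⬝ᵥ mrPoint K m = 0 := h0
      rw [this]
      simp [lamMatrix_apply, Ne.symm hsi]
    · right
      obtain ⟨s, hs⟩ := hcolA h
      rw [hentry] at hs
      have hsi : s ≠ i₀ := by
        rintro rfl
        apply hs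
        have : (fun a => LRPencil.coeffMat B a s s) ⬝ᵥ mrPoint K m = 0 := hlx
        rw [this]
        simp [lamMatrix_apply]
      refine ⟨⟨s, Finset.mem_erase.mpr ⟨hsi, Finset.mem_univ _⟩⟩, fun h0 => hs ?_⟩
      have : (fun a => LRPencil.coeffMat B a s i₀) ⬝ᵥ mrPoint K m = 0 := h0
      rw [this]
      simp [lamMatrix_apply, hsi]
  -- the count
  have hκ' : (((m + 3 : ℕ) : K) - 1) ≠ 0 := by
    have : (((m + 3 : ℕ) : K) - 1) = ((m + 2 : ℕ) : K) := by push_cast; ring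
    rw [this]
    exact_mod_cast Nat.succ_ne_zero (m + 1)
  have hcount := card_le_two_mul_of_row_or_col_ne_zero l t (mrPoint K m) r c H _ hκ' hH hinj
    heuler hlx hBvec
  have hJ : Fintype.card ↥(Finset.univ.erase i₀) = N - 1 := by
    rw [Fintype.card_coe, Finset.card_erase_of_mem (Finset.mem_univ _), Finset.card_univ,
      Fintype.card_fin]
  rw [Fintype.card_prod, Fintype.card_fin, hJ] at hcount
  have hsq : (m + 3) ^ 2 = (m + 3) * (m + 3) := sq _
  omega

end OddStep

/-- **The registered stub `stub_pointLemma`** (skeleton `Cruxes/BeyondHessianNs/Lines/Sketch.lean`): the point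
lemma over any field of characteristic `0`, as registered on the crux item. -/
theorem stub_pointLemma : ∀ {K : Type} [Field K] [CharZero K] {m N : ℕ}
    (A : Matrix (Fin N) (Fin N) (MvPolynomial (Fin (m + 3) × Fin (m + 3)) K)),
    Literature.Computability.AlgebraicComplexity.IsAffineDetRepr
        (Literature.Computability.AlgebraicComplexity.perPoly (Fin (m + 3)) K) A →
      ((A.map (MvPolynomial.eval (Literature.Computability.AlgebraicComplexity.mrPoint K m))).adjugate *
            Literature.Computability.AlgebraicComplexity.constPart A ≠ 0 ∨
          Literature.Computability.AlgebraicComplexity.constPart A *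
            (A.map (MvPolynomial.eval (Literature.Computability.AlgebraicComplexity.mrPoint K m))).adjugate ≠ 0) →
        (m + 3) ^ 2 + 2 ≤ 2 * N :=
  fun A hA hB => sq_add_two_le_of_kernelPair_ne A hA hB

end Summit.ValiantsHypothesis.ValiantsHypothesis.Theorems.RefutationDegreeBeyondHessianNs

end
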